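import Literature.MathematicalPhysics.QuantumFieldTheory.Balaban1983to89.B1Ineq226HolderRegularRegion
import Literature.MathematicalPhysics.QuantumFieldTheory.Balaban1983to89.B1Ineq226RegularRegionSum
import Literature.MathematicalPhysics.QuantumFieldTheory.Balaban1983to89.B1Cor23RegularNestedFam
import Literature.MathematicalPhysics.QuantumFieldTheory.Balaban1983to89.B1Claim18RegularRegionFam

/-!
# `Balaban1983to89.B1Prop21RegularRegionFam` — T. Bałaban, *(Higgs)₂,₃ quantum fields in a finite volume. I. A lower bound*,
# Commun. Math. Phys. **85** (1982) 603–626 [Balaban1982Higgs1]: **PROPOSITION 2.1 (2.23)–(2.26) IN ITS TYPED FORM (`B1.Prop21Printed`, ruled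
# reading `0 ≦ α < 1` = [Balaban1983RegularityDecay]'s Theorem p. 573 `B4.ThmPrintedNN`) INHABITED BY THE (Higgs)₂,₃ CARRIER'S OWN OPERATORS ON
# THE FAMILY OF NESTED PAIRS OF BIG-BLOCK REGIONS `Ω ⊆ Ω₀ ⊂ T_ε` AT EVERY (2.23)-REGULAR VECTOR FIELD** — every functional of (2.24)–(2.26) LIVE
# (`δG_k(Ω, Ω₀, A) = G_k(Ω, A) − G_k(Ω₀, A)` non-trivial, `R₀` live, the additional factor `exp(−δ₀dist(supp f, Ωᶜ) − δ₀dist({x,x′}, Ωᶜ))` live),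
# assembling this seat's gens 12–13; and, on the SAME family (r14's index `Cor23NestedIdx` of nested pairs), [13]'s in-text claim (1.8)
# (`B4.Claim18Printed`, from r14's `coercive_covOpK_of_reg223`) and Corollary 2.3 (2.30) (`B4.Cor23Printed`, r14's `cor23Printed_regNestedFam23`
# re-read): the whole typed §1 of [13] for one family of the concrete carrier

statement-level skeleton of published theorems with citation tags; proofs where landed; nothing here is a claim about the Yang–Mills mass gap

PDF held: `paper:balaban1982-cmp85-higgs23-i` pp. 610–611 [PDF 8–9] (text layer re-read by this seat, `p0008.txt` L25–43, `p0009.txt` L1–4; the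
a/α swap of the OCR at L33 resolved by the ×2 render as in gen 13's audited headers); `paper:balaban1983-cmp89-regularity-decay` p. 573 [PDF 3]
(`p0003.txt` L2–27).

CITATION HEADER (lean-in-tree rule).  Cell `lit-balaban` (HOME `run/shared/lean/pub/lit-balaban/`), Phase-2 proof seat **p35** gen 14 (unit
`lit-balaban-p35`; TAKING line HOME/STATUS.md 2026-08-22T17:17:21Z); SKELETON rows **B1.Prop2.1** (decl of record `…B1.Prop21Printed`, pv07, UNCHANGED;
fold owner r14; kind «model instance»: the typed leaf on a family built from the CONCRETE carrier — the REGION companion of gen 11's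
`B1Prop21RegularTorusFam` (`Ω = Ω₀ = T_ε`, `δG = 0`)), xref r01's **B4.Thm@573**, **B4.Claim18**, **B4.Cor2.3** (MODEL-INSTANCE cells only; decls of
record `B4.{ThmPrinted, Claim18Printed, Cor23Printed}` are b04's).  USED BY NAME, never restated: b04 `B4.{EtaSetting, Ineq19_110, Ineq111_112,
Claim18Printed, Cor23Printed}`, pv17 `B4Ineq111ZeroNestEta.ThmPrintedNN`, pv07 `B1.{Ineq224_225, Ineq226}`, p14 `B1Prop21ZeroField.prop21NN_iff_thmPrintedNN`;
r14 `B1Cor23RegularDiagFam.{Cor23Idx, regDiagFam23, suppF}`, `B1Cor23RegularNestedFam.{Cor23NestedIdx, regNestedFam23, bdistSteps,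
cor23Printed_regNestedFam23}`, `B1Ineq18RegularRegion.coercive_covOpK_of_reg223`, `B1Ineq234LevelZero.tdist_comm`; gen 11
`B1Prop21RegularTorusFam.RegTorusIdx.{holderQ, holderQ_le, TAdm}`, `B1Claim18RegularTorusFam.{threshold_reg223, gamma18_pos}`; gens 12–13
`B1Ineq225RegularRegion.{norm_propagatorK_region_reg_decay_sum, rS_le_real}`, `B1Ineq225DerivRegularRegion.norm_covDeriv_propagatorK_region_reg_decay_sum`,
`B1Ineq224RegularRegion.norm_holder_propagatorK_region_reg_decay_sum`, `B1Ineq226RegularRegionSum.deltaG_region_reg_decay_sum`,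
`B1Ineq226HolderRegularRegion.holder_deltaG_region_reg_decay_sum`; gen 8 `B1Ineq225BackgroundTorus.three_half_le_sites`,
`B1TorusRegionHSizes.{IsBigBlockUnion, isBigBlockUnion_univ, blockSat_of_isBigBlockUnion}`, `B1TorusRegionRop.{chi, chi_smul_eq_self}`,
`B1TorusCubeCover.half`, `B1TorusCubeLocality26.rS`, the typer's `HiggsLattice` / `HiggsCovariance.{propagatorK, covOpK}`.

WHAT IS PRINTED.  [B1] p. 610 [PDF 8] L25–43, p. 611 [PDF 9] L1–4: *«Proposition 2.1. Let a set Ω satisfies Ω = B^k(Ω^{(k)}) and let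
Ω^{(k)} ⊂ T₁^{(k)} be a sum of big blocks with M sufficiently large. Further, let a configuration A be regular on Ω in the sense that
|(∂^η_μA)(x)| ≤ c(e(L^kε))^{β−1}, x ∈ Ω, μ = 1, …, d, (2.23) where e(L^kε) = e(L^kε)^{(4−d)/2}, η = L^{−k}, β > 0 and c is some universal constant.
For an arbitrary pair of points x, x′ ∈ T_η let us denote yb [sic] Γ_{x,x′} a shortest contour connecting these points. Then for e(L^kε)
sufficiently small and α < 1 there exist positive constants δ₀, c₀, R₀ independent of A, k, Ω and depending on d, a, M only, c₀ on α also, such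
that for an arbitrary function f : Ω → R^N we have (1/|x − x′|^α)|U(A(Γ_{x,x′}))(D^η_{A,μ}G_k(Ω, A)f)(x′) − (D^η_{A,μ}G_k(Ω, A)f)(x)|
≤ c₀ exp(−δ₀ dist({x, x′}, supp f))‖f‖_∞ (2.24) for x, x′ ∈ Ω and satisfying the condition dist({x, x′}, Ω^c) ≥ R₀. Similarly we have
|(D^η_{A,μ}G_k(Ω, A)f)(x)|, |(G_k(Ω, A)f)(x)| ≤ c₀ exp(−δ₀ dist(x, supp f))‖f‖_∞ (2.25) for x ∈ Ω, dist(x, Ω^c) ≥ R₀. If Ω ⊂ Ω₀, then for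
δG_k(Ω, Ω₀, A) defined by the equality δG_k(Ω, Ω₀, A) = G_k(Ω, A) − G_k(Ω₀, A), (2.26) we have the inequalities (2.24), (2.25) with the
additional factor exp(−δ₀ dist(supp f, Ω^c) − δ₀ dist({x, x′}, Ω^c)) on the right sides. For some simple sets Ω, e.g. for rectangular
parallelepipeds, the inequalities hold without any restrictions on the points x, x′, i.e. for all x, x′ ∈ Ω. Let us notice that Ω^c means a
complement in T_η, so in the case Ω = T_η the condition dist({x, x′}, Ω^c) ≥ R₀ is meaningless and is omitted.»*; p. 610 L20–23: *«In the sequel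
the properties of the propagator G^ε_k(Ω, A) rescaled to the η-lattice, η = L^{−k}, will be very important. Let us notice that the rescaled
propagator is given by G_k(Ω, A) = (−Δ^{η,N}_{A,Ω} + m²(L^kε)² + a_kP_k(A))^{−1} (2.22)»*.  [13] p. 573 [PDF 3] L2–7: *«The operator defining the
Green's function (1.6) has a strictly positive lower bound. More exactly we prove that there exists a positive constant γ₀ such that for e
sufficiently small and for a regular vector field A −Δ^{η,N}_{A,Ω} + aP_k(A) ≥ γ₀I. (1.8) The constant γ₀ is independent of the lattice spacing
η, as well as of Ω and of A.»*; L12: *«Theorem (Proposition 2.1 of [1]).»*.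

THE FAMILY (`regPairFam d L K₀ C a m² c β : Cor23NestedIdx d L → B4.EtaSetting`; a definition with a body, a RECORD UPDATE of r14's
`regNestedFam23 d L C a m² c β`).  A MEMBER `i` (r14's index, reused verbatim) is a torus `P` of the carrier (`P.d = d`, `P.L = L`), a level
`1 ≦ k ≦ K_P` with `L^kε ≦ 1`, a NESTED PAIR `Ω ⊆ Ω₀` of unions of `k`-fold blocks of `T_ε`, a vector field `A` on the bonds of `T_ε`, an effective
coupling `e_k` (the print's `e(L^kε)`; any positive normalisation).  Fields KEPT from r14: `Site`, `Dir`, `Src` = the fields `f : T_ε → ℝ^N` SUPPORTED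
IN `Ω` («f : Ω → R^N»), `e := e_k`, `regular` := (2.23) bond by bond at the sites of `Ω₀` (`(L^kε|e|/e_k)|A_μ(z + εe_ν) − A_μ(z)| ≦ c·e_k^{β−1}/L^k`),
`pdist`, `supNorm f = ‖f‖_∞`, `l2Norm`, `ssdist`, `bdistS f = dist(supp f, Ωᶜ)/L^k`, `pair`, `dpair` (the eight Cor. 2.3 pairings).  Fields SET
here: `bigBlocks := K₀ ∣ M ∧ 3K₀ ≦ 2M ∧ Ω, Ω₀ big-block unions of size K₀` («Ω^{(k)} ⊂ T₁^{(k)} be a sum of big blocks with M sufficiently large»;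
`K₀` is the print's `M`, the cube size of the random walk; `M` here is the torus datum of (1.2)); `rect := (Ω = T_ε)` («in the case Ω = T_η the
condition … is meaningless and is omitted»); `sdist1 x f = dist(x, supp f)/L^k`, `sdist2 x x′ f = dist({x,x′}, supp f)/L^k`, `bdist1 x =
dist(x, Ωᶜ)/L^k`, `bdist2 x x′ = dist({x,x′}, Ωᶜ)/L^k` ((1.3) lattice steps of `T_ε` divided by `L^k` = `η`-units; `0` for an empty set);
`valG f x = |(G_k(Ω,A)f)(x)| := ‖(G^ε_k(Ω,A)f)(x)‖/(L^kε)²`, `valDG μ f x := ‖(D^ε_AG^ε_k(Ω,A)f)(⟨x,μ⟩)‖/(L^kε)` (the rescaling (2.20) ↔ (2.22):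
`G_k = (L^kε)^{−2}G^ε_k`, `D^η = (L^kε)D^ε`), `lhs19 α μ f x x′` := gen 11's Hölder quotient `sup_Γ (|x − x′|/L^k)^{−α}‖U(A(Γ))(D^ε_AG^ε_kf)(⟨x′,μ⟩) −
(D^ε_AG^ε_kf)(⟨x,μ⟩)‖/(L^kε)` over the admissible contours (nearest-neighbour chains from `x` to `x′ ≠ x` with `|Γ| ≦ d|x − x′|`); `dvalG`, `dvalDG`,
`dlhs19` := the same three functionals of `δG^ε_k(Ω,Ω₀,A)f = G^ε_k(Ω,A)f − G^ε_k(Ω₀,A)f` (2.26); `lower18 γ` := (1.8) `γ‖φ‖² ≦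
(L^kε)²⟨φ, (−Δ^{ε,N}_{A,Ω} + a_k(L^kε)^{−2}P_k(A))φ⟩` for `φ` supported in `Ω`.

WHAT THIS FILE PROVES (kernel-checked, zero `sorry`; axioms standard).
* §1 `setDist` (+ `setDist_nonneg`, `setDist_le`), `outside`, `bdistSteps_le_tdist`, `toT` (the member's torus datum as gen 11's `RegTorusIdx`),
  `regPairFam` and its `rfl` lemmas; §2 `mem_of_near` (`R₀ = (2d + 5)K₀` in `η`-units makes the site-form hypothesis of gens 12–13 hold).
* §3 **`thmPrintedNN_regPairFam`**: for `d ≧ 1`, `L ≧ 2`, `a > 0`, `m² > 0`, `N`, `(e, q)`, `c ≧ 0`, `β > 0` there is `K₀min` such that for every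
  `K₀ ≧ K₀min`, `B4.ThmPrintedNN (regPairFam d L K₀ C a m² c β)`: `∀ 0 ≦ α < 1 ∃ δ₀ c₀ R₀ e₁ > 0 ∀ members, regular → bigBlocks → 0 < e_k ≦ e₁ →
  Ineq19_110 ∧ Ineq111_112` — ALL SIX MEMBERS (Hölder / derivative / value × `G` / `δG`) from the five `_sum` theorems of gens 12–13 (`δ₀ =
  1/(8K₀)`, `c₀` = max, `e₁` = min, `R₀ = (2d + 5)K₀`); **`prop21NN_regPairFam`**: the same read through p14's bridge as `B1.Ineq224_225 ∧ B1.Ineq226`.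
* §4 **`claim18Printed_regPairFam`**: `B4.Claim18Printed (regPairFam d L K₀ C a m² c β)` for every `K₀` (γ₀ = min{2, a(1 − L^{−2})/4} BEFORE the
  member; r14's `coercive_covOpK_of_reg223` on `Ω`); **`cor23Printed_regPairFam`**: `B4.Cor23Printed (regPairFam d L K₀ C a m² c β)` for every `K₀`
  (r14's `cor23Printed_regNestedFam23` — the `pair`/`dpair`/`ssdist`/`bdistS`/`l2Norm`/`regular` fields are r14's, untouched);
  **`sect1_typed_regPairFam`**: the conjunction of the three leaves for `K₀ ≧ K₀min`; `regPairFam_nonvacuous`.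
HONEST SCOPE.  (i) MODEL INSTANCE of the typed leaves on the concrete carrier; no head claim (rows B1.Prop2.1 / B4.Thm@573 are already `proved`
by their owners' ledgers).  (ii) `regular` is asked at the sites of `Ω₀ ⊇ Ω` (the propagator `G_k(Ω₀,A)` of `δG_k` lives on `Ω₀`; for the `G_k(Ω,A)`
clauses only the sites of `Ω` are used).  (iii) «big blocks»: `Ω, Ω₀` unions of the `K₀L^k`-cubes of the `K₀`-grid and the torus tiled by them
(`K₀ ∣ M`, `3K₀ ≦ 2M`), «M sufficiently large» = `K₀ ≧ K₀min(d, L, a, m², N, e, q, c, β)`; `m² > 0` with `L^kε ≦ 1`; `L ≧ 2`.  (iv) `R₀ = (2d + 5)K₀`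
and `δ₀ = 1/(8K₀)` per `η`-unit are explicit and unoptimised (print: `R₀`, `δ₀` «depending on d, a, M only»); `c₀, e₁` existential.  (v) the
parallelepiped sentence is realised only for `Ω = T_ε` (`rect`); for a proper box `Ω ⊊ T_ε` the restriction `R₀` is kept (not claimed).  (vi) the
literal leaf «∀ α < 1» (negative `α`) is not asserted — ruled reading `0 ≦ α`, as for every family of the cell.  (vii) NOT summit progress.
Unit `lit-balaban-p35` gen 14 (literature-prover-lit-balaban-p35-g14-0).
-/

open scoped BigOperators

noncomputable section

namespace Literature.MathematicalPhysics.QuantumFieldTheory.Balaban1983to89.B1Prop21RegularRegionFam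

open Literature.MathematicalPhysics.QuantumFieldTheory.Balaban1983to89.HiggsLattice (ChargeData ScalarField covDeriv siteInner)
open Literature.MathematicalPhysics.QuantumFieldTheory.Balaban1983to89.HiggsCovariance (propagatorK covOpK)
open Literature.MathematicalPhysics.QuantumFieldTheory.Balaban1983to89.B4 (EtaSetting Ineq19_110 Ineq111_112 Claim18Printed Cor23Printed)
open Literature.MathematicalPhysics.QuantumFieldTheory.Balaban1983to89.B4Ineq111ZeroNestEta (ThmPrintedNN)
open Literature.MathematicalPhysics.QuantumFieldTheory.Balaban1983to89.B1 (Ineq224_225 Ineq226)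
open Literature.MathematicalPhysics.QuantumFieldTheory.Balaban1983to89.B1Prop21ZeroField (prop21NN_iff_thmPrintedNN)
open Literature.MathematicalPhysics.QuantumFieldTheory.Balaban1983to89.B4GaugeCovariance (pathEnd)
open Literature.MathematicalPhysics.QuantumFieldTheory.Balaban1983to89.B1TorusChainTransport (IsTChain hol)
open Literature.MathematicalPhysics.QuantumFieldTheory.Balaban1983to89.B1Prop21RegularTorusFam (RegTorusIdx)
open Literature.MathematicalPhysics.QuantumFieldTheory.Balaban1983to89.B1Cor23RegularDiagFam (Cor23Idx regDiagFam23 suppF)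
open Literature.MathematicalPhysics.QuantumFieldTheory.Balaban1983to89.B1Cor23RegularNestedFam (Cor23NestedIdx regNestedFam23 bdistSteps
  bdistSteps_nonneg cor23Printed_regNestedFam23)
open Literature.MathematicalPhysics.QuantumFieldTheory.Balaban1983to89.B1TorusCubeCover (half)
open Literature.MathematicalPhysics.QuantumFieldTheory.Balaban1983to89.B1TorusCubeLocality26 (rS)
open Literature.MathematicalPhysics.QuantumFieldTheory.Balaban1983to89.B1TorusRegionHSizes (IsBigBlockUnion isBigBlockUnion_univ
  blockSat_of_isBigBlockUnion)
open Literature.MathematicalPhysics.QuantumFieldTheory.Balaban1983to89.B1TorusRegionRop (chi chi_smul_eq_self)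
open Literature.MathematicalPhysics.QuantumFieldTheory.Balaban1983to89.B1Ineq225RegularRegion (norm_propagatorK_region_reg_decay_sum rS_le_real)
open Literature.MathematicalPhysics.QuantumFieldTheory.Balaban1983to89.B1Ineq225DerivRegularRegion (norm_covDeriv_propagatorK_region_reg_decay_sum)
open Literature.MathematicalPhysics.QuantumFieldTheory.Balaban1983to89.B1Ineq224RegularRegion (norm_holder_propagatorK_region_reg_decay_sum)
open Literature.MathematicalPhysics.QuantumFieldTheory.Balaban1983to89.B1Ineq226RegularRegionSum (deltaG_region_reg_decay_sum)
open Literature.MathematicalPhysics.QuantumFieldTheory.Balaban1983to89.B1Ineq226HolderRegularRegion (holder_deltaG_region_reg_decay_sum)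
open Literature.MathematicalPhysics.QuantumFieldTheory.Balaban1983to89.B1Ineq225BackgroundTorus (three_half_le_sites)
open Literature.MathematicalPhysics.QuantumFieldTheory.Balaban1983to89.B1Ineq18RegularRegion (coercive_covOpK_of_reg223)
open Literature.MathematicalPhysics.QuantumFieldTheory.Balaban1983to89.B1Claim18RegularTorusFam (threshold_reg223 gamma18_pos)
open Literature.MathematicalPhysics.QuantumFieldTheory.Balaban1983to89.B1Ineq234LevelZero (tdist_comm)

variable {N : ℕ}

/-! ## §1 Distances, the torus datum of a member, and the family -/

section Dist

variable {P : HiggsLattice.Params}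

open Classical in
/-- `dist(x, S) = min_{z ∈ S} |x − z|` in lattice steps of `T_ε` (the (1.3) torus distance; `0` for `S = ∅`). [cite: Balaban1982Higgs1, (1.3) p.604;
Prop. 2.1 p.610 «dist(x, supp f)», «dist(x, Ω^c)»] -/
def setDist (S : Finset (HiggsLattice.Site P 0)) (x : HiggsLattice.Site P 0) : ℝ :=
  if h : S.Nonempty then ((S.inf' h fun z => HiggsLattice.Site.tdist x z : ℕ) : ℝ) else 0

/-- `dist(x, S) ≥ 0`. [cite: Balaban1982Higgs1, (1.3) p.604] -/
theorem setDist_nonneg (S : Finset (HiggsLattice.Site P 0)) (x : HiggsLattice.Site P 0) : 0 ≤ setDist S x := by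
  unfold setDist; split_ifs <;> positivity

/-- `dist(x, S) ≤ |x − z|` for `z ∈ S`. [cite: Balaban1982Higgs1, (1.3) p.604] -/
theorem setDist_le {S : Finset (HiggsLattice.Site P 0)} (x : HiggsLattice.Site P 0) {z : HiggsLattice.Site P 0} (hz : z ∈ S) :
    setDist S x ≤ (HiggsLattice.Site.tdist x z : ℝ) := by
  have hne : S.Nonempty := ⟨z, hz⟩
  unfold setDist
  rw [dif_pos hne]
  exact_mod_cast Finset.inf'_le (fun z => HiggsLattice.Site.tdist x z) hz

/-- `Ω^c` («Ω^c means a complement in T_η»). [cite: Balaban1982Higgs1, Prop. 2.1 p.611] -/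
def outside (Ω : Finset (HiggsLattice.Site P 0)) : Finset (HiggsLattice.Site P 0) := Finset.univ.filter fun y => y ∉ Ω

/-- membership in `Ω^c`. [cite: Balaban1982Higgs1, Prop. 2.1 p.611] -/
theorem mem_outside {Ω : Finset (HiggsLattice.Site P 0)} {y : HiggsLattice.Site P 0} : y ∈ outside Ω ↔ y ∉ Ω := by
  unfold outside; simp

/-- r14's `dist(supp f, Ω^c)` is below `|z − y|` for `f(y) ≠ 0`, `z ∉ Ω`. [cite: Balaban1982Higgs1, Prop. 2.1 (2.26) p.610 «dist(supp f, Ω^c)»] -/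
theorem bdistSteps_le_tdist (Ω : Finset (HiggsLattice.Site P 0)) {f : ScalarField P 0 N} {y z : HiggsLattice.Site P 0} (hy : f y ≠ 0)
    (hz : z ∉ Ω) : bdistSteps Ω f ≤ (HiggsLattice.Site.tdist z y : ℝ) := by
  classical
  have hmem : (y, z) ∈ suppF f ×ˢ (Finset.univ.filter fun y : HiggsLattice.Site P 0 => y ∉ Ω) := by
    rw [Finset.mem_product]
    refine ⟨?_, Finset.mem_filter.2 ⟨Finset.mem_univ _, hz⟩⟩
    unfold suppF
    exact Finset.mem_filter.2 ⟨Finset.mem_univ _, hy⟩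
  have hne : (suppF f ×ˢ (Finset.univ.filter fun y : HiggsLattice.Site P 0 => y ∉ Ω)).Nonempty := ⟨_, hmem⟩
  unfold bdistSteps
  rw [dif_pos hne, tdist_comm z y]
  exact_mod_cast Finset.inf'_le (fun p : HiggsLattice.Site P 0 × HiggsLattice.Site P 0 => HiggsLattice.Site.tdist p.1 p.2) hmem

/-- membership in `supp f`. [cite: Balaban1982Higgs1, Prop. 2.1 p.610 «supp f»] -/
theorem mem_suppF {f : ScalarField P 0 N} {z : HiggsLattice.Site P 0} (hz : f z ≠ 0) : z ∈ suppF f := by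
  classical
  unfold suppF
  exact Finset.mem_filter.2 ⟨Finset.mem_univ _, hz⟩

end Dist

variable {d L : ℕ}

/-- The member's torus datum `(P, k, A, e_k)` as gen 11's `RegTorusIdx d L 1` (mesh cap `L^kε ≦ 1`), so that gen 11's Hölder quotient `holderQ`
and its admissible contours `TAdm` are REUSED for regions. [cite: Balaban1982Higgs1, Prop. 2.1 (2.24) p.610] -/
def toT (i : Cor23NestedIdx d L) : RegTorusIdx d L 1 := ⟨i.P, i.hPd, i.hPL, i.k, i.hk1, i.hk, i.hs, i.A, i.ec⟩

/-- **THE FAMILY OF SETTINGS OF PROP. 2.1 BUILT FROM THE (Higgs)₂,₃ CARRIER ON NESTED PAIRS OF BIG-BLOCK REGIONS AT EVERY (2.23)-REGULAR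
FIELD** — a record update of r14's `regNestedFam23` (module docstring «THE FAMILY» for the reading of each field). [cite: Balaban1982Higgs1,
Prop. 2.1 (2.23)–(2.26) pp.610–611; (2.20), (2.22) p.610] [cite: Balaban1983RegularityDecay, (1.8), Theorem (1.9)–(1.12) p.573] -/
def regPairFam (d L K₀ : ℕ) (C : ChargeData N) (a msq creg β : ℝ) (i : Cor23NestedIdx d L) : EtaSetting :=
  { regNestedFam23 d L C a msq creg β i with
    bigBlocks := K₀ ∣ i.P.M ∧ 3 * K₀ ≤ 2 * i.P.M ∧ IsBigBlockUnion i.k K₀ i.Ω ∧ IsBigBlockUnion i.k K₀ i.Ω₀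
    rect := i.Ω = Finset.univ
    sdist1 := fun x f => setDist (suppF f.1) x / (i.P.L : ℝ) ^ i.k
    sdist2 := fun x x' f => min (setDist (suppF f.1) x) (setDist (suppF f.1) x') / (i.P.L : ℝ) ^ i.k
    bdist1 := fun x => setDist (outside i.Ω) x / (i.P.L : ℝ) ^ i.k
    bdist2 := fun x x' => min (setDist (outside i.Ω) x) (setDist (outside i.Ω) x') / (i.P.L : ℝ) ^ i.k
    lhs19 := fun α μ f x x' => (toT i).holderQ C α μ (covDeriv C i.A (propagatorK C i.Ω i.A msq a i.k f.1)) x x'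
    valDG := fun μ f x => ‖covDeriv C i.A (propagatorK C i.Ω i.A msq a i.k f.1) ⟨x, μ⟩‖ / i.P.mesh i.k
    valG := fun f x => ‖propagatorK C i.Ω i.A msq a i.k f.1 x‖ / i.P.mesh i.k ^ 2
    dlhs19 := fun α μ f x x' =>
      (toT i).holderQ C α μ (covDeriv C i.A (propagatorK C i.Ω i.A msq a i.k f.1 - propagatorK C i.Ω₀ i.A msq a i.k f.1)) x x'
    dvalDG := fun μ f x => ‖covDeriv C i.A (propagatorK C i.Ω i.A msq a i.k f.1 - propagatorK C i.Ω₀ i.A msq a i.k f.1) ⟨x, μ⟩‖ / i.P.mesh i.k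
    dvalG := fun f x => ‖(propagatorK C i.Ω i.A msq a i.k f.1 - propagatorK C i.Ω₀ i.A msq a i.k f.1) x‖ / i.P.mesh i.k ^ 2
    lower18 := fun γ => ∀ φ : ScalarField i.P 0 N, (∀ x, x ∉ i.Ω → φ x = 0) →
      γ * siteInner φ φ ≤ i.P.mesh i.k ^ 2 * siteInner φ (covOpK C i.Ω i.A 0 a i.k φ) }

/-- the Cor. 2.3 pairings of the family ARE r14's. [cite: Balaban1983RegularityDecay, Cor. 2.3 (2.30) pp.580–581] -/
theorem regPairFam_pair (K₀ : ℕ) (C : ChargeData N) (a msq creg β : ℝ) (i : Cor23NestedIdx d L) :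
    (regPairFam d L K₀ C a msq creg β i).pair = (regNestedFam23 d L C a msq creg β i).pair := rfl

/-- the Cor. 2.3 `δG` pairings of the family ARE r14's. [cite: Balaban1983RegularityDecay, Cor. 2.3 p.581, (1.11) p.573] -/
theorem regPairFam_dpair (K₀ : ℕ) (C : ChargeData N) (a msq creg β : ℝ) (i : Cor23NestedIdx d L) :
    (regPairFam d L K₀ C a msq creg β i).dpair = (regNestedFam23 d L C a msq creg β i).dpair := rfl

/-- the regularity hypothesis of the family IS r14's ((2.23) at the sites of `Ω₀`). [cite: Balaban1982Higgs1, Prop. 2.1 (2.23) p.610] -/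
theorem regPairFam_regular (K₀ : ℕ) (C : ChargeData N) (a msq creg β : ℝ) (i : Cor23NestedIdx d L) :
    (regPairFam d L K₀ C a msq creg β i).regular = (regNestedFam23 d L C a msq creg β i).regular := rfl

/-! ## §2 The restriction `R₀` in site form -/

/-- **`R₀ = (2d + 5)K₀` SERVES**: if `Ω = T_ε` or `dist(x, Ω^c) ≥ R₀L^k` lattice steps, then every site within `2r_S + 2K₀L^k(d + 1) + 1` steps of
`x` lies in `Ω` (the site-form hypothesis of gens 12–13; `r_S ≦ (3/4)K₀L^k`, `K₀ ≥ 8`). [cite: Balaban1982Higgs1, Prop. 2.1 p.610 «for x ∈ Ω,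
dist(x, Ω^c) ≥ R₀», p.611 «in the case Ω = T_η the condition … is meaningless and is omitted»] -/
theorem mem_of_near {P : HiggsLattice.Params} {K K₀ : ℕ} (hK₀8 : 8 ≤ K₀) {Ω : Finset (HiggsLattice.Site P 0)} {x : HiggsLattice.Site P 0}
    (hx : Ω = Finset.univ ∨ ((2 * P.d + 5) * K₀ : ℝ) ≤ setDist (outside Ω) x / (P.L : ℝ) ^ K) :
    ∀ y, HiggsLattice.Site.tdist x y ≤ 2 * rS P K K₀ + 2 * half P K K₀ * (P.d + 1) + 1 → y ∈ Ω := by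
  intro y hy
  rcases hx with hΩ | hR
  · rw [hΩ]; exact Finset.mem_univ _
  · by_contra hyΩ
    have hLK : (0 : ℝ) < (P.L : ℝ) ^ K := pow_pos (by exact_mod_cast P.hL) K
    have hmem : y ∈ outside Ω := mem_outside.2 hyΩ
    have h1 : setDist (outside Ω) x ≤ (HiggsLattice.Site.tdist x y : ℝ) := setDist_le x hmem
    have h2 : ((2 * P.d + 5) * K₀ : ℝ) * (P.L : ℝ) ^ K ≤ (HiggsLattice.Site.tdist x y : ℝ) := by
      rw [le_div_iff₀ hLK] at hR; exact hR.trans h1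
    have hrS : (rS P K K₀ : ℝ) ≤ 3 / 4 * half P K K₀ := rS_le_real hK₀8
    have hhalf : (half P K K₀ : ℝ) = (P.L : ℝ) ^ K * K₀ := by unfold half; push_cast; ring
    have hK₀r : (8 : ℝ) ≤ K₀ := by exact_mod_cast hK₀8
    have hL1 : (1 : ℝ) ≤ (P.L : ℝ) ^ K := one_le_pow₀ (by exact_mod_cast P.hL)
    have hy' : (HiggsLattice.Site.tdist x y : ℝ) ≤ 2 * rS P K K₀ + 2 * half P K K₀ * (P.d + 1) + 1 := by exact_mod_cast hy
    have hd0 : (0 : ℝ) ≤ P.d := Nat.cast_nonneg _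
    have hhalf8 : (8 : ℝ) ≤ half P K K₀ := by
      rw [hhalf]; nlinarith
    -- `2r_S + 2·half·(d+1) + 1 ≤ (2d + 3.5)·half + 1 < (2d + 5)·half = R₀L^K`
    have : ((2 * P.d + 5) * K₀ : ℝ) * (P.L : ℝ) ^ K = (2 * P.d + 5) * half P K K₀ := by rw [hhalf]; ring
    rw [this] at h2
    nlinarith

/-! ## §3 The Theorem p. 573 / Prop. 2.1 in typed form on the family -/

/-- exponential weights compare: `c ≦ c′`, `δ′ ≦ δ`, `s ≧ 0` ⇒ `c·e^{−δs}M ≦ c′·e^{−δ′s}M`. [folklore] -/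
private theorem weight_mono {c c' δ δ' s M : ℝ} (hc : c ≤ c') (hc' : 0 ≤ c') (hδ : δ' ≤ δ) (hs : 0 ≤ s) (hM : 0 ≤ M) :
    c * Real.exp (-(δ * s)) * M ≤ c' * Real.exp (-(δ' * s)) * M := by
  have h1 : Real.exp (-(δ * s)) ≤ Real.exp (-(δ' * s)) := Real.exp_le_exp.2 (by nlinarith)
  have h2 : c * Real.exp (-(δ * s)) ≤ c' * Real.exp (-(δ' * s)) :=
    (mul_le_mul_of_nonneg_right hc (Real.exp_nonneg _)).trans (mul_le_mul_of_nonneg_left h1 hc')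
  exact mul_le_mul_of_nonneg_right h2 hM

/-- the rate bookkeeping of the `G` clauses: `D/(4K₀L^k) = (1/(4K₀))·(D/L^k)`. [folklore] -/
private theorem rate_four {K₀r Lk D : ℝ} (hK : 0 < K₀r) (hL : 0 < Lk) : D / (4 * K₀r * Lk) = 1 / (4 * K₀r) * (D / Lk) := by
  field_simp

/-- the rate bookkeeping of the `δG` clauses: `e^{−(D + D₀ + D₁)/(8K₀L^k)} = e^{−δ₀D/L^k}·e^{−(δ₀D₀/L^k + δ₀D₁/L^k)}`, `δ₀ = 1/(8K₀)`. [folklore] -/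
private theorem rate_eight {K₀r Lk D D₀ D₁ : ℝ} (hK : 0 < K₀r) (hL : 0 < Lk) :
    Real.exp (-((D + D₀ + D₁) / (8 * K₀r * Lk)))
      = Real.exp (-(1 / (8 * K₀r) * (D / Lk))) * Real.exp (-(1 / (8 * K₀r) * (D₀ / Lk) + 1 / (8 * K₀r) * (D₁ / Lk))) := by
  rw [← Real.exp_add]
  congr 1
  field_simp
  ring

set_option maxHeartbeats 1600000 in
/-- **B4's THEOREM p. 573 IN pv17's TYPED `η`-UNIFORM FORM `ThmPrintedNN` HOLDS ON THE CARRIER FAMILY `regPairFam` OF NESTED BIG-BLOCK REGION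
PAIRS**: for `d ≧ 1`, `L ≧ 2`, `a > 0`, `m² > 0`, `N`, `(e, q)`, `c ≧ 0`, `β > 0` there is a cube size `K₀min` («M sufficiently large») such that
for every `K₀ ≧ K₀min`: for every `0 ≦ α < 1` there are `δ₀, c₀, R₀, e₁ > 0` such that every member (torus, level, nested pair `Ω ⊆ Ω₀`, field `A`,
coupling `e_k`) which is (2.23)-regular at the sites of `Ω₀`, whose torus is tiled by the `K₀`-cubes (`K₀ ∣ M`, `3K₀ ≦ 2M`) with `Ω, Ω₀` unions of
them, and with `0 < e_k ≦ e₁`, satisfies (2.24)–(2.25) = (1.9)–(1.10) for `G_k(Ω,A)` under `dist(·, Ω^c) ≥ R₀` (no restriction when `Ω = T_ε`) and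
(2.26) = (1.11)–(1.12) for `δG_k(Ω,Ω₀,A)` with the additional factor `exp(−δ₀dist(·, Ω^c) − δ₀dist(supp f, Ω^c))`.  Assembly of
`norm_propagatorK_region_reg_decay_sum`, `norm_covDeriv_propagatorK_region_reg_decay_sum`, `norm_holder_propagatorK_region_reg_decay_sum`,
`deltaG_region_reg_decay_sum`, `holder_deltaG_region_reg_decay_sum` (`δ₀ = 1/(8K₀)`, the maximum of the five constants, the minimum of the
five thresholds, `R₀ = (2d + 5)K₀` by `mem_of_near`). [cite: Balaban1982Higgs1, Prop. 2.1 (2.23)–(2.26) pp.610–611]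
[cite: Balaban1983RegularityDecay, Theorem (1.9)–(1.12) p.573] -/
theorem thmPrintedNN_regPairFam (d L : ℕ) (hd : 1 ≤ d) (hL : 2 ≤ L) {a : ℝ} (ha : 0 < a) {msq : ℝ} (hmsq : 0 < msq) (C : ChargeData N)
    (creg β : ℝ) (hcreg : 0 ≤ creg) (hβ : 0 < β) :
    ∃ K₀min : ℕ, ∀ K₀ : ℕ, K₀min ≤ K₀ → ThmPrintedNN (regPairFam d L K₀ C a msq creg β) := by
  obtain ⟨K₁, H₁⟩ := norm_propagatorK_region_reg_decay_sum d L hd hL ha hmsq N C 1 creg β hcreg hβ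
  obtain ⟨K₂, H₂⟩ := norm_covDeriv_propagatorK_region_reg_decay_sum d L hd hL ha hmsq N C 1 creg β hcreg hβ
  obtain ⟨K₃, H₃⟩ := norm_holder_propagatorK_region_reg_decay_sum d L hd hL ha hmsq N C 1 creg β hcreg hβ
  obtain ⟨K₄, H₄⟩ := deltaG_region_reg_decay_sum d L hd hL ha hmsq N C 1 creg β hcreg hβ
  obtain ⟨K₅, H₅⟩ := holder_deltaG_region_reg_decay_sum d L hd hL ha hmsq N C 1 creg β hcreg hβ
  refine ⟨max (max (max (max (max K₁ K₂) K₃) K₄) K₅) 8, fun K₀ hK₀ => ?_⟩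
  have hK₅ : K₅ ≤ K₀ := le_trans (le_trans (le_max_right _ _) (le_max_left _ _)) hK₀
  have h4 : max (max (max K₁ K₂) K₃) K₄ ≤ K₀ := le_trans (le_trans (le_max_left _ _) (le_max_left _ _)) hK₀
  have hK₄ : K₄ ≤ K₀ := le_trans (le_max_right _ _) h4
  have h3 : max (max K₁ K₂) K₃ ≤ K₀ := le_trans (le_max_left _ _) h4
  have hK₃ : K₃ ≤ K₀ := le_trans (le_max_right _ _) h3
  have h2 : max K₁ K₂ ≤ K₀ := le_trans (le_max_left _ _) h3
  have hK₂ : K₂ ≤ K₀ := le_trans (le_max_right _ _) h2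
  have hK₁ : K₁ ≤ K₀ := le_trans (le_max_left _ _) h2
  have hK₀8 : 8 ≤ K₀ := le_trans (le_max_right _ _) hK₀
  have hK₀r : (0 : ℝ) < K₀ := by exact_mod_cast (show 0 < K₀ by omega)
  intro α hα0 hα1
  obtain ⟨c₁, e₁, hc₁, he₁, T₁⟩ := H₁ K₀ hK₁
  obtain ⟨c₂, e₂, hc₂, he₂, T₂⟩ := H₂ K₀ hK₂
  obtain ⟨c₃, e₃, hc₃, he₃, T₃⟩ := H₃ hα0 hα1 K₀ hK₃
  obtain ⟨c₄, e₄, hc₄, he₄, T₄⟩ := H₄ K₀ hK₄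
  obtain ⟨c₅, e₅, hc₅, he₅, T₅⟩ := H₅ hα0 hα1 K₀ hK₅
  set δ₀ : ℝ := 1 / (8 * K₀) with hδ₀
  set c₀ : ℝ := max (max (max (max c₁ c₂) c₃) c₄) c₅ with hc₀
  set eth : ℝ := min (min (min (min e₁ e₂) e₃) e₄) e₅ with heth
  set R₀ : ℝ := (2 * d + 5) * K₀ with hR₀
  have hδ₀pos : 0 < δ₀ := by positivity
  have hδ₀le : δ₀ ≤ 1 / (4 * K₀) := by
    rw [hδ₀]; gcongr; linarith
  have hcc₅ : c₅ ≤ c₀ := le_max_right _ _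
  have hcc₄ : c₄ ≤ c₀ := (le_max_right _ _).trans (le_max_left _ _)
  have hcc₃ : c₃ ≤ c₀ := ((le_max_right _ _).trans (le_max_left _ _)).trans (le_max_left _ _)
  have hcc₂ : c₂ ≤ c₀ := (((le_max_right _ _).trans (le_max_left _ _)).trans (le_max_left _ _)).trans (le_max_left _ _)
  have hcc₁ : c₁ ≤ c₀ := (((le_max_left _ _).trans (le_max_left _ _)).trans (le_max_left _ _)).trans (le_max_left _ _)
  have hc₀pos : 0 < c₀ := lt_of_lt_of_le hc₁ hcc₁
  have he₅' : eth ≤ e₅ := min_le_right _ _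
  have he₄' : eth ≤ e₄ := (min_le_left _ _).trans (min_le_right _ _)
  have he₃' : eth ≤ e₃ := ((min_le_left _ _).trans (min_le_left _ _)).trans (min_le_right _ _)
  have he₂' : eth ≤ e₂ := (((min_le_left _ _).trans (min_le_left _ _)).trans (min_le_left _ _)).trans (min_le_right _ _)
  have he₁' : eth ≤ e₁ := (((min_le_left _ _).trans (min_le_left _ _)).trans (min_le_left _ _)).trans (min_le_left _ _)
  have hethpos : 0 < eth := lt_min (lt_min (lt_min (lt_min he₁ he₂) he₃) he₄) he₅
  have hR₀pos : 0 < R₀ := by positivity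
  refine ⟨δ₀, c₀, R₀, eth, hδ₀pos, hc₀pos, hR₀pos, hethpos, ?_⟩
  intro i hreg hbig hec hle
  dsimp only [regPairFam, regNestedFam23, regDiagFam23] at hreg hbig hec hle
  obtain ⟨hK₀M, h3M, hΩbig, hΩ₀big⟩ := hbig
  -- the member's data
  have hPd : i.P.d = d := i.hPd
  have hN3 : ∀ μ, 3 * half i.P i.k K₀ ≤ i.P.sitesPerDir 0 μ := fun μ => three_half_le_sites i.hk h3M μ
  have hmesh : 0 < i.P.mesh i.k := i.P.mesh_pos i.k
  have hLK : (0 : ℝ) < (i.P.L : ℝ) ^ i.k := pow_pos (by exact_mod_cast i.P.hL) i.k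
  -- (2.23) in the orientation of gens 12–13, on `Ω₀` and on `Ω`
  have hregΩ₀ : ∀ z ∈ i.Ω₀, ∀ μ ν : Fin i.P.d,
      i.P.mesh i.k * |C.e| / i.ec * |i.A ⟨z.shift μ, ν⟩ - i.A ⟨z, ν⟩| ≤ creg * i.ec ^ (β - 1) / (i.P.L : ℝ) ^ i.k :=
    fun z hz μ ν => hreg z hz ν μ
  have hregΩ : ∀ z ∈ i.Ω, ∀ μ ν : Fin i.P.d,
      i.P.mesh i.k * |C.e| / i.ec * |i.A ⟨z.shift μ, ν⟩ - i.A ⟨z, ν⟩| ≤ creg * i.ec ^ (β - 1) / (i.P.L : ℝ) ^ i.k :=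
    fun z hz μ ν => hregΩ₀ z (i.hsub hz) μ ν
  -- `R₀` in `η`-units ⇒ the site-form restriction (with and without the `+1`)
  have hR₀d : R₀ = ((2 * i.P.d + 5) * K₀ : ℝ) := by rw [hR₀, hPd]
  have hnear : ∀ x : HiggsLattice.Site i.P 0, (i.Ω = Finset.univ ∨ R₀ ≤ setDist (outside i.Ω) x / (i.P.L : ℝ) ^ i.k) →
      ∀ y, HiggsLattice.Site.tdist x y ≤ 2 * rS i.P i.k K₀ + 2 * half i.P i.k K₀ * (i.P.d + 1) + 1 → y ∈ i.Ω := by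
    intro x hx
    refine mem_of_near hK₀8 ?_
    rcases hx with h | h
    · exact Or.inl h
    · exact Or.inr (by rw [← hR₀d]; exact h)
  have hnear' : ∀ x : HiggsLattice.Site i.P 0, (i.Ω = Finset.univ ∨ R₀ ≤ setDist (outside i.Ω) x / (i.P.L : ℝ) ^ i.k) →
      ∀ y, HiggsLattice.Site.tdist x y ≤ 2 * rS i.P i.k K₀ + 2 * half i.P i.k K₀ * (i.P.d + 1) → y ∈ i.Ω :=
    fun x hx y hy => hnear x hx y (le_trans hy (Nat.le_succ _))
  have hnear2 : ∀ x x' : HiggsLattice.Site i.P 0,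
      (i.Ω = Finset.univ ∨ R₀ ≤ min (setDist (outside i.Ω) x) (setDist (outside i.Ω) x') / (i.P.L : ℝ) ^ i.k) →
      (i.Ω = Finset.univ ∨ R₀ ≤ setDist (outside i.Ω) x / (i.P.L : ℝ) ^ i.k) ∧
      (i.Ω = Finset.univ ∨ R₀ ≤ setDist (outside i.Ω) x' / (i.P.L : ℝ) ^ i.k) := by
    intro x x' hx
    rcases hx with h | h
    · exact ⟨Or.inl h, Or.inl h⟩
    · refine ⟨Or.inr (h.trans ?_), Or.inr (h.trans ?_)⟩
      · exact div_le_div_of_nonneg_right (min_le_left _ _) hLK.le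
      · exact div_le_div_of_nonneg_right (min_le_right _ _) hLK.le
  -- sources: fields supported in `Ω ⊆ Ω₀`
  have hχ : ∀ f : (regPairFam d L K₀ C a msq creg β i).Src, chi i.Ω • f.1 = f.1 := fun f => chi_smul_eq_self i.Ω f.2
  have hχ₀ : ∀ f : (regPairFam d L K₀ C a msq creg β i).Src, chi i.Ω₀ • f.1 = f.1 :=
    fun f => chi_smul_eq_self i.Ω₀ fun x hx => f.2 x fun h => hx (i.hsub h)
  have hf0 : ∀ f : (regPairFam d L K₀ C a msq creg β i).Src, 0 ≤ ‖f.1‖ := fun f => norm_nonneg _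
  -- distances
  have hsd0 : ∀ (x : HiggsLattice.Site i.P 0) (f : ScalarField i.P 0 N), 0 ≤ setDist (suppF f) x := fun x f => setDist_nonneg _ _
  have hsdD : ∀ (x : HiggsLattice.Site i.P 0) (f : ScalarField i.P 0 N) (z : HiggsLattice.Site i.P 0), f z ≠ 0 →
      setDist (suppF f) x ≤ (HiggsLattice.Site.tdist x z : ℝ) := fun x f z hz => setDist_le x (mem_suppF hz)
  have hbd0 : ∀ x : HiggsLattice.Site i.P 0, 0 ≤ setDist (outside i.Ω) x := fun x => setDist_nonneg _ _
  have hbdD : ∀ (x z : HiggsLattice.Site i.P 0), z ∉ i.Ω → setDist (outside i.Ω) x ≤ (HiggsLattice.Site.tdist x z : ℝ) :=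
    fun x z hz => setDist_le x (mem_outside.2 hz)
  have hbsD : ∀ (f : ScalarField i.P 0 N) (y z : HiggsLattice.Site i.P 0), f y ≠ 0 → z ∉ i.Ω →
      bdistSteps i.Ω f ≤ (HiggsLattice.Site.tdist z y : ℝ) := fun f y z hy hz => bdistSteps_le_tdist i.Ω hy hz
  refine ⟨⟨?_, ?_⟩, ⟨?_, ?_⟩⟩
  · -- (2.24) / (1.9): the Hölder quotient of `D^ε_AG^ε_k(Ω,A)f`
    dsimp only [regPairFam, regNestedFam23, regDiagFam23]
    intro μ f x x' hxx'
    obtain ⟨hx, hx'⟩ := hnear2 x x' hxx'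
    set D : ℝ := min (setDist (suppF f.1) x) (setDist (suppF f.1) x') with hD
    have hD0 : 0 ≤ D := le_min (hsd0 x f.1) (hsd0 x' f.1)
    have hs : 0 ≤ D / (i.P.L : ℝ) ^ i.k := div_nonneg hD0 hLK.le
    refine (toT i).holderQ_le C (by positivity) fun l hl => ?_
    obtain ⟨hne, hch, hend, hlen⟩ := hl
    have h := T₃ i.P i.hPd i.hPL hK₀M i.hk1 i.hk hN3 i.hs i.Ω hΩbig i.A hec (hle.trans he₃') hregΩ μ x x' hne (hnear x hx) (hnear x' hx')
      l hch hend hlen f.1 ‖f.1‖ D (fun y => norm_le_pi_norm f.1 y) hD0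
      (fun z hz => (min_le_left _ _).trans (hsdD x f.1 z hz)) (fun z hz => (min_le_right _ _).trans (hsdD x' f.1 z hz))
    rw [hχ f] at h
    show (((HiggsLattice.Site.tdist x x' : ℝ) / (i.P.L : ℝ) ^ i.k)⁻¹) ^ α *
        (‖hol C i.A x l (covDeriv C i.A (propagatorK C i.Ω i.A msq a i.k f.1) ⟨x', μ⟩)
            - covDeriv C i.A (propagatorK C i.Ω i.A msq a i.k f.1) ⟨x, μ⟩‖ / i.P.mesh i.k)
      ≤ c₀ * Real.exp (-(δ₀ * (D / (i.P.L : ℝ) ^ i.k))) * ‖f.1‖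
    rw [← mul_div_assoc, div_le_iff₀ hmesh]
    calc (((HiggsLattice.Site.tdist x x' : ℝ) / (i.P.L : ℝ) ^ i.k)⁻¹) ^ α *
          ‖hol C i.A x l (covDeriv C i.A (propagatorK C i.Ω i.A msq a i.k f.1) ⟨x', μ⟩)
            - covDeriv C i.A (propagatorK C i.Ω i.A msq a i.k f.1) ⟨x, μ⟩‖
        ≤ c₃ * i.P.mesh i.k * Real.exp (-(D / (4 * K₀ * (i.P.L : ℝ) ^ i.k))) * ‖f.1‖ := h
      _ = c₃ * Real.exp (-(1 / (4 * K₀) * (D / (i.P.L : ℝ) ^ i.k))) * ‖f.1‖ * i.P.mesh i.k := by rw [rate_four hK₀r hLK]; ring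
      _ ≤ c₀ * Real.exp (-(δ₀ * (D / (i.P.L : ℝ) ^ i.k))) * ‖f.1‖ * i.P.mesh i.k :=
          mul_le_mul_of_nonneg_right (weight_mono hcc₃ hc₀pos.le hδ₀le hs (hf0 f)) hmesh.le
  · -- (2.25) / (1.10): the derivative and the value member of `G^ε_k(Ω,A)f`
    dsimp only [regPairFam, regNestedFam23, regDiagFam23]
    intro μ f x hx
    set D : ℝ := setDist (suppF f.1) x with hD
    have hD0 : 0 ≤ D := hsd0 x f.1
    have hs : 0 ≤ D / (i.P.L : ℝ) ^ i.k := div_nonneg hD0 hLK.le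
    refine ⟨?_, ?_⟩
    · have h := T₂ i.P i.hPd i.hPL hK₀M i.hk1 i.hk hN3 i.hs i.Ω hΩbig i.A hec (hle.trans he₂') hregΩ x μ (hnear x hx)
        f.1 ‖f.1‖ D (fun y => norm_le_pi_norm f.1 y) hD0 (fun z hz => hsdD x f.1 z hz)
      rw [hχ f] at h
      rw [div_le_iff₀ hmesh]
      calc ‖covDeriv C i.A (propagatorK C i.Ω i.A msq a i.k f.1) ⟨x, μ⟩‖
          ≤ c₂ * i.P.mesh i.k * Real.exp (-(D / (4 * K₀ * (i.P.L : ℝ) ^ i.k))) * ‖f.1‖ := h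
        _ = c₂ * Real.exp (-(1 / (4 * K₀) * (D / (i.P.L : ℝ) ^ i.k))) * ‖f.1‖ * i.P.mesh i.k := by rw [rate_four hK₀r hLK]; ring
        _ ≤ c₀ * Real.exp (-(δ₀ * (D / (i.P.L : ℝ) ^ i.k))) * ‖f.1‖ * i.P.mesh i.k :=
            mul_le_mul_of_nonneg_right (weight_mono hcc₂ hc₀pos.le hδ₀le hs (hf0 f)) hmesh.le
    · have h := T₁ i.P i.hPd i.hPL hK₀M i.hk1 i.hk hN3 i.hs i.Ω hΩbig i.A hec (hle.trans he₁') hregΩ x (hnear' x hx)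
        f.1 ‖f.1‖ D (fun y => norm_le_pi_norm f.1 y) hD0 (fun z hz => hsdD x f.1 z hz)
      rw [hχ f] at h
      rw [div_le_iff₀ (pow_pos hmesh 2)]
      calc ‖propagatorK C i.Ω i.A msq a i.k f.1 x‖
          ≤ c₁ * i.P.mesh i.k ^ 2 * Real.exp (-(D / (4 * K₀ * (i.P.L : ℝ) ^ i.k))) * ‖f.1‖ := h
        _ = c₁ * Real.exp (-(1 / (4 * K₀) * (D / (i.P.L : ℝ) ^ i.k))) * ‖f.1‖ * i.P.mesh i.k ^ 2 := by rw [rate_four hK₀r hLK]; ring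
        _ ≤ c₀ * Real.exp (-(δ₀ * (D / (i.P.L : ℝ) ^ i.k))) * ‖f.1‖ * i.P.mesh i.k ^ 2 :=
            mul_le_mul_of_nonneg_right (weight_mono hcc₁ hc₀pos.le hδ₀le hs (hf0 f)) (pow_pos hmesh 2).le
  · -- (2.26) with (2.24) / (1.11)–(1.12) with (1.9): the Hölder quotient of `D^ε_AδG^ε_k(Ω,Ω₀,A)f`
    dsimp only [regPairFam, regNestedFam23, regDiagFam23]
    intro μ f x x' hxx'
    obtain ⟨hx, hx'⟩ := hnear2 x x' hxx'
    set D : ℝ := min (setDist (suppF f.1) x) (setDist (suppF f.1) x') with hD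
    set D₀ : ℝ := min (setDist (outside i.Ω) x) (setDist (outside i.Ω) x') with hD₀
    set D₁ : ℝ := bdistSteps i.Ω f.1 with hD₁
    have hD0 : 0 ≤ D := le_min (hsd0 x f.1) (hsd0 x' f.1)
    have hD₀0 : 0 ≤ D₀ := le_min (hbd0 x) (hbd0 x')
    have hD₁0 : 0 ≤ D₁ := bdistSteps_nonneg _ _
    have hs : 0 ≤ D / (i.P.L : ℝ) ^ i.k := div_nonneg hD0 hLK.le
    have hb : 0 ≤ Real.exp (-(δ₀ * (D₀ / (i.P.L : ℝ) ^ i.k) + δ₀ * (D₁ / (i.P.L : ℝ) ^ i.k))) := Real.exp_nonneg _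
    refine (toT i).holderQ_le C (by positivity) fun l hl => ?_
    obtain ⟨hne, hch, hend, hlen⟩ := hl
    have h := T₅ i.P i.hPd i.hPL hK₀M i.hk1 i.hk hN3 i.hs i.Ω i.Ω₀ hΩbig hΩ₀big i.hsub i.A hec (hle.trans he₅') hregΩ₀ μ x x' hne
      (hnear x hx) (hnear x' hx') l hch hend hlen f.1 ‖f.1‖ D D₀ D₁ (fun y => norm_le_pi_norm f.1 y) hD0 hD₀0 hD₁0
      (fun z hz => (min_le_left _ _).trans (hsdD x f.1 z hz)) (fun z hz => (min_le_right _ _).trans (hsdD x' f.1 z hz))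
      (fun z hz => (min_le_left _ _).trans (hbdD x z hz)) (fun z hz => (min_le_right _ _).trans (hbdD x' z hz))
      (fun y z hy hz => hbsD f.1 y z hy hz)
    rw [hχ f, hχ₀ f] at h
    show (((HiggsLattice.Site.tdist x x' : ℝ) / (i.P.L : ℝ) ^ i.k)⁻¹) ^ α *
        (‖hol C i.A x l (covDeriv C i.A (propagatorK C i.Ω i.A msq a i.k f.1 - propagatorK C i.Ω₀ i.A msq a i.k f.1) ⟨x', μ⟩)
            - covDeriv C i.A (propagatorK C i.Ω i.A msq a i.k f.1 - propagatorK C i.Ω₀ i.A msq a i.k f.1) ⟨x, μ⟩‖ / i.P.mesh i.k)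
      ≤ c₀ * Real.exp (-(δ₀ * (D / (i.P.L : ℝ) ^ i.k)))
          * Real.exp (-(δ₀ * (D₀ / (i.P.L : ℝ) ^ i.k) + δ₀ * (D₁ / (i.P.L : ℝ) ^ i.k))) * ‖f.1‖
    rw [← mul_div_assoc, div_le_iff₀ hmesh]
    calc (((HiggsLattice.Site.tdist x x' : ℝ) / (i.P.L : ℝ) ^ i.k)⁻¹) ^ α *
          ‖hol C i.A x l (covDeriv C i.A (propagatorK C i.Ω i.A msq a i.k f.1 - propagatorK C i.Ω₀ i.A msq a i.k f.1) ⟨x', μ⟩)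
            - covDeriv C i.A (propagatorK C i.Ω i.A msq a i.k f.1 - propagatorK C i.Ω₀ i.A msq a i.k f.1) ⟨x, μ⟩‖
        ≤ c₅ * i.P.mesh i.k * Real.exp (-((D + D₀ + D₁) / (8 * K₀ * (i.P.L : ℝ) ^ i.k))) * ‖f.1‖ := h
      _ = c₅ * Real.exp (-(δ₀ * (D / (i.P.L : ℝ) ^ i.k)))
            * Real.exp (-(δ₀ * (D₀ / (i.P.L : ℝ) ^ i.k) + δ₀ * (D₁ / (i.P.L : ℝ) ^ i.k))) * ‖f.1‖ * i.P.mesh i.k := by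
          rw [rate_eight hK₀r hLK]; ring
      _ ≤ c₀ * Real.exp (-(δ₀ * (D / (i.P.L : ℝ) ^ i.k)))
            * Real.exp (-(δ₀ * (D₀ / (i.P.L : ℝ) ^ i.k) + δ₀ * (D₁ / (i.P.L : ℝ) ^ i.k))) * ‖f.1‖ * i.P.mesh i.k := by
          gcongr
  · -- (2.26) with (2.25) / (1.11)–(1.12) with (1.10): the derivative and the value member of `δG^ε_k(Ω,Ω₀,A)f`
    dsimp only [regPairFam, regNestedFam23, regDiagFam23]
    intro μ f x hx
    set D : ℝ := setDist (suppF f.1) x with hD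
    set D₀ : ℝ := setDist (outside i.Ω) x with hD₀
    set D₁ : ℝ := bdistSteps i.Ω f.1 with hD₁
    have hD0 : 0 ≤ D := hsd0 x f.1
    have hD₀0 : 0 ≤ D₀ := hbd0 x
    have hD₁0 : 0 ≤ D₁ := bdistSteps_nonneg _ _
    have h := T₄ i.P i.hPd i.hPL hK₀M i.hk1 i.hk hN3 i.hs i.Ω i.Ω₀ hΩbig hΩ₀big i.hsub i.A hec (hle.trans he₄') hregΩ₀ x (hnear x hx)
      f.1 ‖f.1‖ D D₀ D₁ (fun y => norm_le_pi_norm f.1 y) hD0 hD₀0 hD₁0 (fun z hz => hsdD x f.1 z hz) (fun z hz => hbdD x z hz)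
      (fun y z hy hz => hbsD f.1 y z hy hz)
    rw [hχ f, hχ₀ f] at h
    obtain ⟨hV, hDμ⟩ := h
    refine ⟨?_, ?_⟩
    · have h := hDμ μ
      rw [div_le_iff₀ hmesh]
      calc ‖covDeriv C i.A (propagatorK C i.Ω i.A msq a i.k f.1 - propagatorK C i.Ω₀ i.A msq a i.k f.1) ⟨x, μ⟩‖
          ≤ c₄ * i.P.mesh i.k * Real.exp (-((D + D₀ + D₁) / (8 * K₀ * (i.P.L : ℝ) ^ i.k))) * ‖f.1‖ := h
        _ = c₄ * Real.exp (-(δ₀ * (D / (i.P.L : ℝ) ^ i.k)))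
              * Real.exp (-(δ₀ * (D₀ / (i.P.L : ℝ) ^ i.k) + δ₀ * (D₁ / (i.P.L : ℝ) ^ i.k))) * ‖f.1‖ * i.P.mesh i.k := by
            rw [rate_eight hK₀r hLK]; ring
        _ ≤ c₀ * Real.exp (-(δ₀ * (D / (i.P.L : ℝ) ^ i.k)))
              * Real.exp (-(δ₀ * (D₀ / (i.P.L : ℝ) ^ i.k) + δ₀ * (D₁ / (i.P.L : ℝ) ^ i.k))) * ‖f.1‖ * i.P.mesh i.k := by
            gcongr
    · rw [div_le_iff₀ (pow_pos hmesh 2)]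
      calc ‖(propagatorK C i.Ω i.A msq a i.k f.1 - propagatorK C i.Ω₀ i.A msq a i.k f.1) x‖
          ≤ c₄ * i.P.mesh i.k ^ 2 * Real.exp (-((D + D₀ + D₁) / (8 * K₀ * (i.P.L : ℝ) ^ i.k))) * ‖f.1‖ := hV
        _ = c₄ * Real.exp (-(δ₀ * (D / (i.P.L : ℝ) ^ i.k)))
              * Real.exp (-(δ₀ * (D₀ / (i.P.L : ℝ) ^ i.k) + δ₀ * (D₁ / (i.P.L : ℝ) ^ i.k))) * ‖f.1‖ * i.P.mesh i.k ^ 2 := by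
            rw [rate_eight hK₀r hLK]; ring
        _ ≤ c₀ * Real.exp (-(δ₀ * (D / (i.P.L : ℝ) ^ i.k)))
              * Real.exp (-(δ₀ * (D₀ / (i.P.L : ℝ) ^ i.k) + δ₀ * (D₁ / (i.P.L : ℝ) ^ i.k))) * ‖f.1‖ * i.P.mesh i.k ^ 2 := by
            gcongr

/-- **PROPOSITION 2.1, RULED READING `0 ≦ α < 1`, HOLDS FOR THE (Higgs)₂,₃ CARRIER'S OWN OPERATORS ON THE NESTED BIG-BLOCK REGION PAIRS OF
`T_ε` AT EVERY (2.23)-REGULAR FIELD**: for `d ≧ 1`, `L ≧ 2`, `a > 0`, `m² > 0`, `N`, `(e,q)`, `c ≧ 0`, `β > 0` there is `K₀min` («M sufficiently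
large») such that for every `K₀ ≧ K₀min` and every `0 ≦ α < 1` there are `δ₀, c₀, R₀, e₁ > 0` with: every member of `regPairFam d L K₀ C a m² c β` —
every torus, every level `1 ≦ k ≦ K_P` with `L^kε ≦ 1`, every nested pair `Ω ⊆ Ω₀` of big-block unions, EVERY vector field `A` regular in the
sense (2.23) on `Ω₀`, coupling `0 < e_k ≦ e₁` («e(L^kε) sufficiently small») — satisfies (2.24)–(2.25) (`B1.Ineq224_225`) for `G_k(Ω, A)` and
(2.26) (`B1.Ineq226`) for `δG_k(Ω, Ω₀, A) = G_k(Ω, A) − G_k(Ω₀, A)`, for `G^ε_k` of (2.20) rescaled as (2.22).  p14's bridge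
`prop21NN_iff_thmPrintedNN` applied to `thmPrintedNN_regPairFam`. [cite: Balaban1982Higgs1, Prop. 2.1 (2.23)–(2.26) pp.610–611] -/
theorem prop21NN_regPairFam (d L : ℕ) (hd : 1 ≤ d) (hL : 2 ≤ L) {a : ℝ} (ha : 0 < a) {msq : ℝ} (hmsq : 0 < msq) (C : ChargeData N)
    (creg β : ℝ) (hcreg : 0 ≤ creg) (hβ : 0 < β) :
    ∃ K₀min : ℕ, ∀ K₀ : ℕ, K₀min ≤ K₀ →
      ∀ α : ℝ, 0 ≤ α → α < 1 → ∃ δ₀ c₀ R₀ e₁ : ℝ, 0 < δ₀ ∧ 0 < c₀ ∧ 0 < R₀ ∧ 0 < e₁ ∧ ∀ i : Cor23NestedIdx d L,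
        (regPairFam d L K₀ C a msq creg β i).regular → (regPairFam d L K₀ C a msq creg β i).bigBlocks →
        0 < (regPairFam d L K₀ C a msq creg β i).e → (regPairFam d L K₀ C a msq creg β i).e ≤ e₁ →
          Ineq224_225 (regPairFam d L K₀ C a msq creg β i) α δ₀ c₀ R₀ ∧ Ineq226 (regPairFam d L K₀ C a msq creg β i) α δ₀ c₀ R₀ := by
  obtain ⟨K₀min, h⟩ := thmPrintedNN_regPairFam d L hd hL ha hmsq C creg β hcreg hβ
  exact ⟨K₀min, fun K₀ hK₀ => (prop21NN_iff_thmPrintedNN _).2 (h K₀ hK₀)⟩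

/-! ## §4 (1.8) and Cor. 2.3 on the same family; the typed §1 of [13] together -/

/-- **THE IN-TEXT CLAIM (1.8), TYPED (`B4.Claim18Printed`), HOLDS ON `regPairFam`** for every `d`, `L ≧ 2`, `a > 0`, `N`, `(e, q)`, `c ≧ 0`,
`β > 0`, every `m²`, every cube size `K₀`: `γ₀ = min{2, a(1 − L^{−2})/4}` and `e₁ = (3(d²c + 1))^{−1/β}` BEFORE the member («independent of the
lattice spacing η, as well as of Ω and of A»); for a member regular at the sites of `Ω₀ ⊇ Ω` with `0 < e_k ≦ e₁`, `γ₀‖φ‖² ≦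
(L^kε)²⟨φ, (−Δ^{ε,N}_{A,Ω} + a_k(L^kε)^{−2}P_k(A))φ⟩` for every `φ` supported in `Ω` — r14's `coercive_covOpK_of_reg223` on the block union `Ω`.
[cite: Balaban1983RegularityDecay, (1.8) p.573] [cite: Balaban1982Higgs1, (2.20), (2.22), Prop. 2.1 (2.23) p.610] -/
theorem claim18Printed_regPairFam (d L K₀ : ℕ) (hL : 2 ≤ L) {a : ℝ} (ha : 0 < a) (msq : ℝ) (C : ChargeData N) {creg : ℝ}
    (hcreg : 0 ≤ creg) {β : ℝ} (hβ : 0 < β) :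
    Claim18Printed (regPairFam d L K₀ C a msq creg β) := by
  obtain ⟨e₁, he₁, hsm⟩ := threshold_reg223 d hcreg hβ
  refine ⟨_, e₁, gamma18_pos ha hL, he₁, fun i hreg hec hle => ?_⟩
  dsimp only [regPairFam, regNestedFam23, regDiagFam23] at hreg hec hle ⊢
  intro φ hφ
  have hPL1 : 1 < i.P.L := by rw [i.hPL]; omega
  have hsmall : (i.P.d : ℝ) ^ 2 * creg * i.ec ^ β ≤ 1 / 3 := by rw [i.hPd]; exact hsm i.ec hec hle
  have hregΩ : ∀ z ∈ i.Ω, ∀ μ ν : Fin i.P.d,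
      i.P.mesh i.k * |C.e| / i.ec * |i.A ⟨z.shift ν, μ⟩ - i.A ⟨z, μ⟩| ≤ creg * i.ec ^ (β - 1) / (i.P.L : ℝ) ^ i.k :=
    fun z hz μ ν => hreg z (i.hsub hz) μ ν
  have h := coercive_covOpK_of_reg223 C ha hPL1 i.hk1 i.hk i.Ω i.hΩ i.A hec hregΩ hsmall 0 φ hφ
  rw [add_zero, i.hPL] at h
  have hm : 0 < i.P.mesh i.k := i.P.mesh_pos i.k
  have key : min 2 (a * (1 - ((L : ℝ) ^ 2)⁻¹) / 4) * siteInner φ φ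
      = i.P.mesh i.k ^ 2 * (min 2 (a * (1 - ((L : ℝ) ^ 2)⁻¹) / 4) * ((i.P.mesh i.k)⁻¹ ^ 2) * siteInner φ φ) := by
    field_simp
  rw [key]
  exact mul_le_mul_of_nonneg_left h (sq_nonneg _)

/-- **COROLLARY 2.3 (2.30), BOTH SENTENCES, TYPED (`B4.Cor23Printed`), HOLDS ON `regPairFam`** for every `d`, `L ≧ 2`, `a > 0`, `m² > 0`, `N`,
`(e, q)`, `c ≧ 0`, `β > 0`, every `K₀`: the family's `regular`, `e`, `pair`, `dpair`, `ssdist`, `bdistS`, `l2Norm` fields are r14's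
`regNestedFam23`'s (untouched by the record update), so r14's `cor23Printed_regNestedFam23` is the proof (its `bigBlocks := True` hypothesis is
discharged trivially; ours is simply not used). [cite: Balaban1983RegularityDecay, Cor. 2.3 (2.30) pp.580–581] -/
theorem cor23Printed_regPairFam (d L K₀ : ℕ) (hL : 2 ≤ L) {a : ℝ} (ha : 0 < a) {msq : ℝ} (hmsq : 0 < msq) (C : ChargeData N)
    {creg : ℝ} (hcreg : 0 ≤ creg) {β : ℝ} (hβ : 0 < β) :
    Cor23Printed (regPairFam d L K₀ C a msq creg β) := by
  obtain ⟨c₀, δ₀, e₁, hc, hδ, he, H⟩ := cor23Printed_regNestedFam23 d L hL ha hmsq C hcreg hβ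
  exact ⟨c₀, δ₀, e₁, hc, hδ, he, fun i hreg _ hec hle => H i hreg trivial hec hle⟩

/-- **THE TYPED §1 OF [13] — the claim (1.8), the Theorem (1.9)–(1.12) (= [B1] Prop. 2.1 (2.23)–(2.26), ruled reading) and Corollary 2.3 (2.30) —
HOLDS TOGETHER ON ONE FAMILY OF THE CONCRETE CARRIER**, the nested big-block region pairs of `T_ε` at every (2.23)-regular field, for every cube
size `K₀ ≧ K₀min`. [cite: Balaban1983RegularityDecay, (1.8), Theorem (1.9)–(1.12) p.573, Cor. 2.3 (2.30) pp.580–581]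
[cite: Balaban1982Higgs1, Prop. 2.1 (2.23)–(2.26) pp.610–611] -/
theorem sect1_typed_regPairFam (d L : ℕ) (hd : 1 ≤ d) (hL : 2 ≤ L) {a : ℝ} (ha : 0 < a) {msq : ℝ} (hmsq : 0 < msq) (C : ChargeData N)
    {creg : ℝ} (hcreg : 0 ≤ creg) {β : ℝ} (hβ : 0 < β) :
    ∃ K₀min : ℕ, ∀ K₀ : ℕ, K₀min ≤ K₀ →
      Claim18Printed (regPairFam d L K₀ C a msq creg β) ∧ ThmPrintedNN (regPairFam d L K₀ C a msq creg β) ∧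
        Cor23Printed (regPairFam d L K₀ C a msq creg β) := by
  obtain ⟨K₀min, h⟩ := thmPrintedNN_regPairFam d L hd hL ha hmsq C creg β hcreg hβ
  exact ⟨K₀min, fun K₀ hK₀ =>
    ⟨claim18Printed_regPairFam d L K₀ hL ha msq C hcreg hβ, h K₀ hK₀, cor23Printed_regPairFam d L K₀ hL ha hmsq C hcreg hβ⟩⟩

/-- **Non-vacuity**: every torus of the carrier with these `d, L` tiled by the `K₀`-cubes (`K₀ ∣ M`, `3K₀ ≦ 2M`), every level `1 ≦ k ≦ K_P` with
`L^kε ≦ 1`, every nested pair `Ω ⊆ Ω₀` of big-block unions (e.g. `Ω = Ω₀ = T_ε`, or any pair) carries, at `A = 0` and `e_k = e₁`, a member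
meeting all four antecedents (`regular`, `bigBlocks`, `0 < e_k ≦ e₁`) for every `c ≧ 0` and every threshold `e₁ > 0`. [cite: Balaban1982Higgs1,
Prop. 2.1 p.610] -/
theorem regPairFam_nonvacuous (C : ChargeData N) (a msq : ℝ) {creg : ℝ} (hcreg : 0 ≤ creg) (β : ℝ) {K₀ : ℕ}
    (P : HiggsLattice.Params) (hPd : P.d = d) (hPL : P.L = L) (hK₀M : K₀ ∣ P.M) (h3M : 3 * K₀ ≤ 2 * P.M) {k : ℕ} (hk1 : 1 ≤ k)
    (hk : k ≤ P.K) (hs : P.mesh k ≤ 1) (Ω Ω₀ : Finset (HiggsLattice.Site P 0)) (hΩ : IsBigBlockUnion k K₀ Ω) (hΩ₀ : IsBigBlockUnion k K₀ Ω₀)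
    (hsub : Ω ⊆ Ω₀) {e₁ : ℝ} (he₁ : 0 < e₁) :
    ∃ i : Cor23NestedIdx d L, i.P = P ∧ i.k = k ∧ HEq i.Ω Ω ∧ HEq i.Ω₀ Ω₀ ∧
      (regPairFam d L K₀ C a msq creg β i).regular ∧ (regPairFam d L K₀ C a msq creg β i).bigBlocks ∧
      0 < (regPairFam d L K₀ C a msq creg β i).e ∧ (regPairFam d L K₀ C a msq creg β i).e ≤ e₁ := by
  refine ⟨⟨⟨P, hPd, hPL, k, hk1, hk, hs, Ω, blockSat_of_isBigBlockUnion hk hΩ, 0, e₁⟩, Ω₀, blockSat_of_isBigBlockUnion hk hΩ₀, hsub⟩,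
    rfl, rfl, HEq.rfl, HEq.rfl, ?_, ⟨hK₀M, h3M, hΩ, hΩ₀⟩, he₁, le_rfl⟩
  dsimp only [regPairFam, regNestedFam23, regDiagFam23]
  intro z _ μ ν
  rw [Pi.zero_apply, Pi.zero_apply, sub_self, abs_zero, mul_zero]
  have hL0 : (0 : ℝ) ≤ (P.L : ℝ) ^ k := by positivity
  exact div_nonneg (mul_nonneg hcreg (Real.rpow_nonneg he₁.le _)) hL0

/-- … in particular the whole torus `Ω = Ω₀ = T_ε` of the torus with `M = 2K₀`, `L′_μ = 1`, `K_P = k = 1`, `ε = 1/L` is a member meeting all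
antecedents (`d ≧ 1`, `L ≧ 2`, `K₀ ≧ 1`). [cite: Balaban1982Higgs1, Prop. 2.1 p.610 «paper we will use the case Ω = T_ε only»] -/
theorem regPairFam_nonvacuous_torus (hd : 1 ≤ d) (hL : 2 ≤ L) (C : ChargeData N) (a msq : ℝ) {creg : ℝ} (hcreg : 0 ≤ creg) (β : ℝ)
    {K₀ : ℕ} (hK₀ : 1 ≤ K₀) {e₁ : ℝ} (he₁ : 0 < e₁) :
    ∃ i : Cor23NestedIdx d L,
      (regPairFam d L K₀ C a msq creg β i).regular ∧ (regPairFam d L K₀ C a msq creg β i).bigBlocks ∧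
      0 < (regPairFam d L K₀ C a msq creg β i).e ∧ (regPairFam d L K₀ C a msq creg β i).e ≤ e₁ := by
  have hL0 : 0 < L := by omega
  have hLr : (0 : ℝ) < L := by exact_mod_cast hL0
  set P : HiggsLattice.Params := ⟨d, 1 / L, 1, L, 2 * K₀, fun _ => 1, hd, div_pos one_pos hLr, hL0, by omega, fun _ => one_pos⟩ with hP
  have hmesh : P.mesh 1 ≤ 1 := by
    show (L : ℝ) ^ 1 * (1 / L) ≤ 1
    rw [pow_one, mul_one_div_cancel hLr.ne']
  obtain ⟨i, -, -, -, -, h⟩ := regPairFam_nonvacuous (d := d) (L := L) C a msq hcreg β P rfl rfl (Dvd.intro_left 2 rfl)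
    (show 3 * K₀ ≤ 2 * (2 * K₀) by omega) le_rfl le_rfl hmesh Finset.univ Finset.univ isBigBlockUnion_univ isBigBlockUnion_univ
    (Finset.Subset.refl _) he₁
  exact ⟨i, h⟩

end Literature.MathematicalPhysics.QuantumFieldTheory.Balaban1983to89.B1Prop21RegularRegionFam

end
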